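import Mathlib
import Summits.Ventures.PercRepro2.Defs
import Summits.Ventures.PercRepro2.Independence
import Summits.Ventures.PercRepro2.Harris
import Summits.Ventures.PercRepro2.Graph
import Summits.Ventures.PercRepro2.Exploration
import Summits.Ventures.PercRepro2.Events
import Summits.Ventures.PercRepro2.FourFunctions
import Summits.Ventures.PercRepro2.Induced
import Summits.Ventures.PercRepro2.Frontier
import Summits.Ventures.PercRepro2.ObsIndependence
import Summits.Ventures.PercRepro2.BHK
import Summits.Ventures.PercRepro2.BHKEvents
import Summits.Ventures.PercRepro2.OrderPreservation
import Summits.Ventures.PercRepro2.BHKAvoid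
import Summits.Ventures.PercRepro2.SameClusterAvoid
import Summits.Ventures.PercRepro2.CaseOneRegime
import Summits.Ventures.PercRepro2.CaseOnePos
import Summits.Ventures.PercRepro2.CaseOneJ11
import Summits.Ventures.PercRepro2.CaseOneRV
import Summits.Ventures.PercRepro2.CaseOnePendant
import Summits.Ventures.PercRepro2.CaseOnePendantAny
import Summits.Ventures.PercRepro2.CaseOnePendantNec
import Summits.Ventures.PercRepro2.HullDefs
import Summits.Ventures.PercRepro2.OneEdge
import Summits.Ventures.PercRepro2.StarPattern
import Summits.Ventures.PercRepro2.HCov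
import Summits.Ventures.PercRepro2.HCovSwap
import Summits.Ventures.PercRepro2.OddsLemma
import Summits.Ventures.PercRepro2.RV
import Summits.Ventures.PercRepro2.RVBridge
import Summits.Ventures.PercRepro2.CaseOneDWorld
import Summits.Ventures.PercRepro2.CaseOneDWorldPin

/-!
# The pendant-`a₃` identity in the D-world (blind cell PercRepro2, p1 g14; S5 §2.1 (K9),
proofs/P1-DWORLD.md §2, identity (L))

`a₃` is a leaf at `v` IN THE SUPPORT of the weight vector (`IsLeafSupp`: one edge `e₀ = {v, a₃}`,
every other edge at `a₃` of weight `0`) — the situation after the root edges of `a₃` have been pinned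
closed by `CaseOneDWorldEdge.lean`. With `r = p(e₀)` and `p' = p[e₀ ↦ 0]` (the instance `G − a₃`):

  **`iiExprD_leaf_supp`**:  `iiExprD p (a₃; c₀, c₁) = r · [ (1 − r) · iiExprT p' (v; c₀, c₁) + r · iiExprD p' (v; c₀, c₁) ]`

— the D-world `(ii)` of `a₃` is the `r`-mixture of the Q-world and the D-world `(ii)` of its
neighbour `v` (every `D`-mass splits as `(1 − r) P'(Q) + r P'(Q, v ∉ C₂)`, every `A`-mass carries the
factor `r`: `prob_pin_supp`). The PD pair of `a₃` is the `r`-mixture of the Q pair and the PD pair of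
`v` (`Dpd_leaf_supp`, `Dpdo_leaf_supp`, K8 in the support setting), and the odds condition at such a
mixed pair and the resulting theorem `zSplitIID_of_leaf_supp` are in `CaseOneDWorldOdds.lean`.
Own code; standard axioms.
-/

namespace Summit.Ventures.PercRepro2

namespace CaseOne

/-! ## A leaf in the support -/

section Supp
variable {V : Type*} {E : Type*} [DecidableEq E] {R : Type*} [CommRing R]

/-- **`a₃` is a leaf at `v` in the support of `p`**: `e₀ = {v, a₃}` and every other edge at `a₃`
has weight `0`. -/
structure IsLeafSupp (p : E → R) (ends : E → Sym2 V) (v a₃ : V) (e₀ : E) : Prop where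
  /-- the leaf edge -/
  ends_eq : ends e₀ = s(v, a₃)
  /-- every other edge at `a₃` is null -/
  null : ∀ e, a₃ ∈ ends e → e ≠ e₀ → p e = 0
  /-- the leaf is not its neighbour -/
  ne : v ≠ a₃

/-- The configurations with every non-`e₀` edge at `a₃` closed (the support of `p`). -/
def Good (ends : E → Sym2 V) (a₃ : V) (e₀ : E) (ω : Config E) : Prop :=
  ∀ e, a₃ ∈ ends e → e ≠ e₀ → ω e = false

variable {ends : E → Sym2 V} {a₃ : V} {e₀ : E}

/-- Updating `e₀` preserves `Good`. -/
lemma Good.update {ω : Config E} (h : Good ends a₃ e₀ ω) (c : Bool) :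
    Good ends a₃ e₀ (Function.update ω e₀ c) := by
  intro e he hne
  rw [Function.update_of_ne hne]
  exact h e he hne

/-- With `e₀` closed, a good configuration isolates `a₃`. -/
lemma eq_of_conn_good {ω : Config E} (h : Good ends a₃ e₀ ω) (hω : ω e₀ = false) {x : V}
    (hc : Conn ends ω a₃ x) : x = a₃ := by
  have hS : ∀ y ∈ ({a₃} : Set V), ∀ z, (openGraph ends ω).Adj y z → z ∈ ({a₃} : Set V) := by
    intro y hy z hyz
    rw [Set.mem_singleton_iff] at hy
    rw [hy] at hyz
    obtain ⟨_, e, he, hends⟩ := openGraph_adj.1 hyz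
    have h3 : a₃ ∈ ends e := by rw [hends]; exact Sym2.mem_mk_left _ _
    by_cases hee : e = e₀
    · rw [hee, hω] at he; exact Bool.noConfusion he
    · rw [h e h3 hee] at he; exact Bool.noConfusion he
  exact mem_of_conn_of_closed hS (Set.mem_singleton a₃) hc

variable {v : V}

/-- **Pendant invisibility in the support**: connections among vertices `≠ a₃` ignore `e₀`. -/
lemma conn_iff_update_good (hv : v ≠ a₃) (hends : ends e₀ = s(v, a₃)) {ω : Config E}
    (h : Good ends a₃ e₀ ω) {x y : V} (hx : x ≠ a₃) (hy : y ≠ a₃) :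
    Conn ends ω x y ↔ Conn ends (Function.update ω e₀ false) x y :=
  StarPattern.conn_update_false_pendant (by rw [hends, Sym2.eq_swap]) hv.symm
    (fun g hg hg3 => Or.inr (h g hg3 hg)) hx hy

/-- With `e₀` open, `x ↔ a₃` iff `x ↔ v` in the closed version. -/
lemma conn_update_true_a3_iff (hv : v ≠ a₃) (hends : ends e₀ = s(v, a₃)) {ω : Config E}
    (h : Good ends a₃ e₀ ω) {x : V} (hx : x ≠ a₃) :
    Conn ends (Function.update ω e₀ true) x a₃ ↔ Conn ends (Function.update ω e₀ false) x v := by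
  have h1 : Good ends a₃ e₀ (Function.update ω e₀ true) := h.update true
  have hva : Conn ends (Function.update ω e₀ true) v a₃ :=
    conn_of_openAdj ⟨e₀, by simp, hends⟩
  constructor
  · intro hc
    have hxv : Conn ends (Function.update ω e₀ true) x v := conn_trans hc (conn_symm hva)
    rw [conn_iff_update_good hv hends h1 hx hv] at hxv
    rwa [Function.update_idem] at hxv
  · intro hc
    have hc' : Conn ends (Function.update ω e₀ true) x v :=
      conn_mono (fun e => by
        by_cases he : e = e₀
        · subst he; simp
        · rw [Function.update_of_ne he, Function.update_of_ne he]) hc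
    exact conn_trans hc' hva

/-- With `e₀` closed, nothing but `a₃` is joined to `a₃`. -/
lemma not_conn_update_false_a3 {ω : Config E} (h : Good ends a₃ e₀ ω) {x : V} (hx : x ≠ a₃) :
    ¬ Conn ends (Function.update ω e₀ false) x a₃ := fun hc =>
  hx (eq_of_conn_good (h.update false) (by simp) (conn_symm hc))

end Supp

/-! ## Expectations in the support, and the pinning of `e₀` -/

section SuppExpect
variable {V : Type*} {E : Type*} [Fintype E] [DecidableEq E] {R : Type*} [CommRing R]
variable {ends : E → Sym2 V} {v a₃ : V} {e₀ : E}

omit [DecidableEq E] in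
/-- A configuration opening a null edge has weight `0`. -/
lemma weight_eq_zero_of_null (p : E → R) (ω : Config E) {e : E} (hp : p e = 0) (hω : ω e = true) :
    weight p ω = 0 := by
  unfold weight
  exact Finset.prod_eq_zero (Finset.mem_univ e) (by simp [edgeFactor, hω, hp])

/-- Functions agreeing on good configurations have the same expectation. -/
lemma expect_congr_supp {p : E → R} (hl : IsLeafSupp p ends v a₃ e₀) (f g : Config E → R)
    (hfg : ∀ ω, Good ends a₃ e₀ ω → f ω = g ω) : expect p f = expect p g := by
  unfold expect
  refine Finset.sum_congr rfl fun ω _ => ?_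
  by_cases h : Good ends a₃ e₀ ω
  · rw [hfg ω h]
  · have : ∃ e, a₃ ∈ ends e ∧ e ≠ e₀ ∧ ω e = true := by
      by_contra hc
      apply h
      intro e he hne
      by_contra hω
      exact hc ⟨e, he, hne, by simpa using hω⟩
    obtain ⟨e, he, hne, hω⟩ := this
    rw [weight_eq_zero_of_null p ω (hl.null e he hne) hω]
    ring

/-- **Pinning `e₀` in the support**: if on good configurations `Y` with `e₀` open reads as `Y₁` and
with `e₀` closed as `Y₀` (both evaluated with `e₀` closed), then
`P(Y) = p(e₀) · P'(Y₁) + (1 − p(e₀)) · P'(Y₀)` with `p' = p[e₀ ↦ 0]`. -/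
theorem prob_pin_supp {p : E → R} (hl : IsLeafSupp p ends v a₃ e₀) (Y Y₁ Y₀ : Set (Config E))
    (h₁ : ∀ ω, Good ends a₃ e₀ ω →
      (Function.update ω e₀ true ∈ Y ↔ Function.update ω e₀ false ∈ Y₁))
    (h₀ : ∀ ω, Good ends a₃ e₀ ω →
      (Function.update ω e₀ false ∈ Y ↔ Function.update ω e₀ false ∈ Y₀)) :
    prob p Y = p e₀ * prob (Function.update p e₀ 0) Y₁ +
      (1 - p e₀) * prob (Function.update p e₀ 0) Y₀ := by
  rw [prob_eq_expect_indicator, expect_eq_update_pin p _ e₀, prob_eq_expect_indicator,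
    prob_eq_expect_indicator, expect_update_zero, expect_update_zero]
  have k₁ : expect p (fun ω => Y.indicator (1 : Config E → R) (Function.update ω e₀ true)) =
      expect p (fun ω => Y₁.indicator (1 : Config E → R) (Function.update ω e₀ false)) := by
    refine expect_congr_supp hl _ _ fun ω hω => ?_
    by_cases hm : Function.update ω e₀ false ∈ Y₁
    · simp only [Set.indicator_of_mem ((h₁ ω hω).2 hm), Set.indicator_of_mem hm, Pi.one_apply]
    · rw [Set.indicator_of_notMem (fun h => hm ((h₁ ω hω).1 h)), Set.indicator_of_notMem hm]
  have k₀ : expect p (fun ω => Y.indicator (1 : Config E → R) (Function.update ω e₀ false)) =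
      expect p (fun ω => Y₀.indicator (1 : Config E → R) (Function.update ω e₀ false)) := by
    refine expect_congr_supp hl _ _ fun ω hω => ?_
    by_cases hm : Function.update ω e₀ false ∈ Y₀
    · simp only [Set.indicator_of_mem ((h₀ ω hω).2 hm), Set.indicator_of_mem hm, Pi.one_apply]
    · rw [Set.indicator_of_notMem (fun h => hm ((h₀ ω hω).1 h)), Set.indicator_of_notMem hm]
  rw [k₁, k₀]

end SuppExpect

/-! ## The mass identities -/

section Masses
variable {V : Type*} {E : Type*} [Fintype E] [DecidableEq E] {R : Type*} [CommRing R]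
variable {p : E → R} {ends : E → Sym2 V} {v a₃ : V} {e₀ : E}

omit [Fintype E] in
/-- Membership facts on good configurations, packaged: for `x, y ≠ a₃` the connections of the two
pinned versions agree, `x ↔ a₃` with `e₀` open is `x ↔ v` with `e₀` closed, and nothing is joined to
`a₃` with `e₀` closed. -/
lemma good_facts (hl : IsLeafSupp p ends v a₃ e₀) {ω : Config E} (h : Good ends a₃ e₀ ω) :
    (∀ x y : V, x ≠ a₃ → y ≠ a₃ → (Conn ends (Function.update ω e₀ true) x y ↔
      Conn ends (Function.update ω e₀ false) x y)) ∧
    (∀ x : V, x ≠ a₃ → (Conn ends (Function.update ω e₀ true) x a₃ ↔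
      Conn ends (Function.update ω e₀ false) x v)) ∧
    (∀ x : V, x ≠ a₃ → ¬ Conn ends (Function.update ω e₀ false) x a₃) := by
  refine ⟨fun x y hx hy => ?_, fun x hx => conn_update_true_a3_iff hl.ne hl.ends_eq h hx,
    fun x hx => not_conn_update_false_a3 h hx⟩
  rw [conn_iff_update_good hl.ne hl.ends_eq (h.update true) hx hy, Function.update_idem]

/-- **`P(D(a₃)) = r P'(D(v)) + (1 − r) P'(Q)`.** -/
theorem prob_Dw_leaf_supp (hl : IsLeafSupp p ends v a₃ e₀) {a₁ a₂ : V} (h1 : a₁ ≠ a₃)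
    (h2 : a₂ ≠ a₃) :
    prob p (Dw ends a₁ a₂ a₃) = p e₀ * prob (Function.update p e₀ 0) (Dw ends a₁ a₂ v) +
      (1 - p e₀) * prob (Function.update p e₀ 0) (connEvent ends a₁ a₂)ᶜ := by
  refine prob_pin_supp hl _ _ _ (fun ω hω => ?_) (fun ω hω => ?_)
  · obtain ⟨f0, f1, _⟩ := good_facts hl hω
    simp only [Dw, Set.mem_inter_iff, Set.mem_compl_iff, mem_connEvent]
    rw [f0 a₁ a₂ h1 h2, f1 a₂ h2]
  · obtain ⟨_, _, f2⟩ := good_facts hl hω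
    simp only [Dw, Set.mem_inter_iff, Set.mem_compl_iff, mem_connEvent]
    exact ⟨fun h => h.1, fun h => ⟨h, f2 a₂ h2⟩⟩

/-- **`P(D(a₃), b ∈ C₂) = r P'(D(v), b ∈ C₂) + (1 − r) P'(Q, b ∈ C₂)`.** -/
theorem prob_B_Dw_leaf_supp (hl : IsLeafSupp p ends v a₃ e₀) {a₁ a₂ b : V} (h1 : a₁ ≠ a₃)
    (h2 : a₂ ≠ a₃) (hb : b ≠ a₃) :
    prob p (connEvent ends a₂ b ∩ Dw ends a₁ a₂ a₃) =
      p e₀ * prob (Function.update p e₀ 0) (connEvent ends a₂ b ∩ Dw ends a₁ a₂ v) +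
      (1 - p e₀) * prob (Function.update p e₀ 0) (connEvent ends a₂ b ∩ (connEvent ends a₁ a₂)ᶜ) := by
  refine prob_pin_supp hl _ _ _ (fun ω hω => ?_) (fun ω hω => ?_)
  · obtain ⟨f0, f1, _⟩ := good_facts hl hω
    simp only [Dw, Set.mem_inter_iff, Set.mem_compl_iff, mem_connEvent]
    rw [f0 a₁ a₂ h1 h2, f1 a₂ h2, f0 a₂ b h2 hb]
  · obtain ⟨_, _, f2⟩ := good_facts hl hω
    simp only [Dw, Set.mem_inter_iff, Set.mem_compl_iff, mem_connEvent]
    exact ⟨fun h => ⟨h.1, h.2.1⟩, fun h => ⟨h.1, h.2, f2 a₂ h2⟩⟩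

/-- The four `A`-masses of `a₃` carry the factor `r`: `P(X ∩ {a₃ ∈ C₁} ∩ Q) = r P'(X ∩ {v ∈ C₁} ∩ Q)`
for `X` built from the `a₂`-connections of `b` and `o`. -/
theorem prob_A_leaf_supp (hl : IsLeafSupp p ends v a₃ e₀) {a₁ a₂ : V} (h1 : a₁ ≠ a₃)
    (h2 : a₂ ≠ a₃) (X : Set (Config E))
    (hX : ∀ ω, Good ends a₃ e₀ ω → (Function.update ω e₀ true ∈ X ↔ Function.update ω e₀ false ∈ X)) :
    prob p (X ∩ connEvent ends a₁ a₃ ∩ (connEvent ends a₁ a₂)ᶜ) =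
      p e₀ * prob (Function.update p e₀ 0) (X ∩ connEvent ends a₁ v ∩ (connEvent ends a₁ a₂)ᶜ) := by
  have h := prob_pin_supp hl (X ∩ connEvent ends a₁ a₃ ∩ (connEvent ends a₁ a₂)ᶜ)
    (X ∩ connEvent ends a₁ v ∩ (connEvent ends a₁ a₂)ᶜ) ∅ (fun ω hω => ?_) (fun ω hω => ?_)
  · rw [h, prob_empty]; ring
  · obtain ⟨f0, f1, _⟩ := good_facts hl hω
    simp only [Set.mem_inter_iff, Set.mem_compl_iff, mem_connEvent]
    rw [f0 a₁ a₂ h1 h2, f1 a₁ h1, hX ω hω]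
  · obtain ⟨_, _, f2⟩ := good_facts hl hω
    simp only [Set.mem_inter_iff, Set.mem_compl_iff, mem_connEvent, Set.mem_empty_iff_false,
      iff_false]
    exact fun h => f2 a₁ h1 h.1.2

omit [Fintype E] in
/-- The `a₂`-connection of a vertex `≠ a₃` ignores `e₀` on good configurations. -/
lemma a2_conn_good (hl : IsLeafSupp p ends v a₃ e₀) {a₂ x : V} (h2 : a₂ ≠ a₃) (hx : x ≠ a₃) :
    ∀ ω, Good ends a₃ e₀ ω → (Function.update ω e₀ true ∈ connEvent ends a₂ x ↔
      Function.update ω e₀ false ∈ connEvent ends a₂ x) :=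
  fun ω hω => by simp only [mem_connEvent]; exact (good_facts hl hω).1 a₂ x h2 hx

omit [Fintype E] in
/-- Intersections of events ignoring `e₀` ignore `e₀`. -/
lemma inter_good {X Y : Set (Config E)}
    (hX : ∀ ω, Good ends a₃ e₀ ω → (Function.update ω e₀ true ∈ X ↔ Function.update ω e₀ false ∈ X))
    (hY : ∀ ω, Good ends a₃ e₀ ω → (Function.update ω e₀ true ∈ Y ↔ Function.update ω e₀ false ∈ Y)) :
    ∀ ω, Good ends a₃ e₀ ω → (Function.update ω e₀ true ∈ X ∩ Y ↔
      Function.update ω e₀ false ∈ X ∩ Y) :=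
  fun ω hω => by simp only [Set.mem_inter_iff]; rw [hX ω hω, hY ω hω]

/-- **The PD mass of `a₃` is the `r`-mixture of `P'(Q)` and the PD mass of `v`.** -/
theorem Dpd_leaf_supp (hl : IsLeafSupp p ends v a₃ e₀) {a₁ a₂ : V} (h1 : a₁ ≠ a₃) (h2 : a₂ ≠ a₃) :
    Dpd p ends a₁ a₂ a₃ = p e₀ * Dpd (Function.update p e₀ 0) ends a₁ a₂ v +
      (1 - p e₀) * prob (Function.update p e₀ 0) (connEvent ends a₁ a₂)ᶜ := by
  unfold Dpd
  refine prob_pin_supp hl _ _ _ (fun ω hω => ?_) (fun ω hω => ?_)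
  · obtain ⟨f0, f1, _⟩ := good_facts hl hω
    simp only [Set.mem_inter_iff, Set.mem_compl_iff, mem_connEvent]
    rw [f0 a₁ a₂ h1 h2, f1 a₁ h1, f1 a₂ h2]
  · obtain ⟨_, _, f2⟩ := good_facts hl hω
    simp only [Set.mem_inter_iff, Set.mem_compl_iff, mem_connEvent]
    exact ⟨fun h => h.2, fun h => ⟨⟨f2 a₁ h1, f2 a₂ h2⟩, h⟩⟩

/-- **The `PD ∩ {o ∈ U}` mass of `a₃` is the `r`-mixture of `Dqo` and that of `v`.** -/
theorem Dpdo_leaf_supp (hl : IsLeafSupp p ends v a₃ e₀) {o a₁ a₂ : V} (ho : o ≠ a₃) (h1 : a₁ ≠ a₃)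
    (h2 : a₂ ≠ a₃) :
    Dpdo p ends o a₁ a₂ a₃ = p e₀ * Dpdo (Function.update p e₀ 0) ends o a₁ a₂ v +
      (1 - p e₀) * Dqo (Function.update p e₀ 0) ends o a₁ a₂ := by
  unfold Dpdo Dqo
  refine prob_pin_supp hl _ _ _ (fun ω hω => ?_) (fun ω hω => ?_)
  · obtain ⟨f0, f1, _⟩ := good_facts hl hω
    simp only [Set.mem_inter_iff, Set.mem_compl_iff, Set.mem_union, mem_connEvent]
    rw [f0 a₁ a₂ h1 h2, f1 a₁ h1, f1 a₂ h2, f0 a₁ o h1 ho, f0 a₂ o h2 ho]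
  · obtain ⟨_, _, f2⟩ := good_facts hl hω
    simp only [Set.mem_inter_iff, Set.mem_compl_iff, Set.mem_union, mem_connEvent]
    exact ⟨fun h => ⟨h.1.1.1, h.2⟩, fun h => ⟨⟨⟨h.1, f2 a₁ h1⟩, f2 a₂ h2⟩, h.2⟩⟩

end Masses

/-! ## Identity (L) -/

section IdentityL
variable {V : Type*} {E : Type*} [Fintype E] [DecidableEq E] {R : Type*} [CommRing R]
variable {p : E → R} {ends : E → Sym2 V} {v a₃ : V} {e₀ : E}

/-- **Identity (L)**: for `a₃` a leaf at `v` in the support, with `r = p(e₀)` and `p' = p[e₀ ↦ 0]`,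
`iiExprD p (a₃; c₀, c₁) = r · [(1 − r) · iiExprT p' (v; c₀, c₁) + r · iiExprD p' (v; c₀, c₁)]`. -/
theorem iiExprD_leaf_supp (hl : IsLeafSupp p ends v a₃ e₀) {o a₁ a₂ b : V} (ho : o ≠ a₃)
    (h1 : a₁ ≠ a₃) (h2 : a₂ ≠ a₃) (hb : b ≠ a₃) (c₀ c₁ : R) :
    iiExprD p ends o a₁ a₂ a₃ b c₀ c₁ =
      p e₀ * ((1 - p e₀) * iiExprT (Function.update p e₀ 0) ends o a₁ a₂ v b c₀ c₁ +
        p e₀ * iiExprD (Function.update p e₀ 0) ends o a₁ a₂ v b c₀ c₁) := by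
  rw [iiExprD_eq, iiExprT_eq, iiExprD_eq, prob_Dw_leaf_supp hl h1 h2, prob_B_Dw_leaf_supp hl h1 h2 hb]
  have hB := a2_conn_good hl h2 hb
  have hO := a2_conn_good hl h2 ho
  have e1 : connEvent ends a₂ b ∩ connEvent ends a₁ a₃ ∩ connEvent ends a₂ o ∩
      (connEvent ends a₁ a₂)ᶜ =
      (connEvent ends a₂ b ∩ connEvent ends a₂ o) ∩ connEvent ends a₁ a₃ ∩ (connEvent ends a₁ a₂)ᶜ := by
    ext ω; simp only [Set.mem_inter_iff]; tauto
  have e1' : connEvent ends a₂ b ∩ connEvent ends a₁ v ∩ connEvent ends a₂ o ∩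
      (connEvent ends a₁ a₂)ᶜ =
      (connEvent ends a₂ b ∩ connEvent ends a₂ o) ∩ connEvent ends a₁ v ∩ (connEvent ends a₁ a₂)ᶜ := by
    ext ω; simp only [Set.mem_inter_iff]; tauto
  have e2 : connEvent ends a₁ a₃ ∩ connEvent ends a₂ o ∩ (connEvent ends a₁ a₂)ᶜ =
      connEvent ends a₂ o ∩ connEvent ends a₁ a₃ ∩ (connEvent ends a₁ a₂)ᶜ := by
    ext ω; simp only [Set.mem_inter_iff]; tauto
  have e2' : connEvent ends a₁ v ∩ connEvent ends a₂ o ∩ (connEvent ends a₁ a₂)ᶜ =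
      connEvent ends a₂ o ∩ connEvent ends a₁ v ∩ (connEvent ends a₁ a₂)ᶜ := by
    ext ω; simp only [Set.mem_inter_iff]; tauto
  have hBAO := prob_A_leaf_supp hl h1 h2 _ (inter_good hB hO)
  have hAO := prob_A_leaf_supp hl h1 h2 _ hO
  have hBA := prob_A_leaf_supp hl h1 h2 _ hB
  have hA := prob_A_leaf_supp hl h1 h2 Set.univ (fun _ _ => by simp)
  rw [Set.univ_inter, Set.univ_inter] at hA
  rw [e1, e2, hBAO, hAO, hBA, hA, ← e1', ← e2']
  ring

end IdentityL

end CaseOne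

end Summit.Ventures.PercRepro2
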